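/-
Origin: expansion seat `planner-pub-hodgecm-toy2-g5-0`, handover #2 2026-08-18T08:46:35Z (`HOME/pub-hodgecm-toy2-g5/lean/Toy2g5/PadH0J.lean`, md5 6c99210a, 342 lines);
landed by the gen-7 packager in gate run 27 as `HodgeCM/Model/PadH0J.lean` (import ^import Toy2g5\.PadH0\b→import HodgeCM.Model.PadH0 ×1).
-/
/-
Copyright: pub-hodgecm formalisation cell (harness21, 2026). New file (not vendored).
Origin: HOME/pub-hodgecm-toy2-g5/lean/Toy2g5/PadH0J.lean — session planner-pub-hodgecm-toy2-g5-0 (unit pub-hodgecm-toy2-g5,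
CONSISTENCY seat 2, part (6a)(ii), generation 5).  WIP module `Toy2g5.PadH0J`; intended final place
`HodgeCM/Model/PadH0J.lean` (module `HodgeCM.Model.PadH0J`; kind L5 consistency / non-vacuity layer).  ONE import to
rewrite on landing: `Toy2g5.PadH0` ↦ `HodgeCM.Model.PadH0`.
-/
import Summits.HodgeConjecture.HodgeCM.Model.PadH0_3

/-!
# Datum A for the degree-zero pad: `P(X) = H⁰(X) ⊕ H⁰(X)` with a non-effective weight-`0` structure — N4 is independent

For a finite-dimensional `ℚ`-vector space `B` the **slope-pair structure** `jStructure B` on `B × B` is the weight-`0`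
Hodge structure whose Hodge filtration is `F^p = ⊤ (p ≤ -1)`, `F⁰ = F¹ = L`, `F^p = ⊥ (p ≥ 2)` with

  `L = {(x, -i·x)} ⊆ (B ⊗ ℂ) × (B ⊗ ℂ) = (B × B) ⊗ ℂ`,  `conj L = {(x, i·x)}`,  `L ⊕ conj L = (B × B) ⊗ ℂ`;

it is of type `(1,-1) + (-1,1)` (the structure of `J = (0 -1; 1 0)` on `B ⊕ B`, i.e. `B ⊗ ℚ(i)` with `i` of type
`(1,-1)`), has NO nonzero rational Hodge class of level `0` (`hodgeClasses 0 = ⊥`) and `F⁰ ≠ ⊤` as soon as `B ≠ 0`, and it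
is natural under EVERY `ℚ`-linear map `g : B → B'` acting diagonally (`jStructure_map_F_le`).  Hence, for any universe
`U`, the pad datum

  `U.padDatumJ : P(X) := H⁰(X, ℚ) × H⁰(X, ℚ)`, structure `jStructure (H⁰(X, ℚ))`, `P(f) := f^* × f^*`

satisfies the pad laws whenever `U` is a model (`PadH0J.laws`), and the padded universe `U♭ᴶ := U.padH0 U.padDatumJ` of
`HodgeCM.Model.PadH0`:

* is a model (`PadH0J.modelAxioms`: M1–M28 from those of `U` and `Fact_dimProd`), keeps N1, N2, N3, F4, F5, `Fact_dimProd`,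
  `W_RK4`, the realisation inputs, `PohlmannSpan` and `HC_CM` (both ways) — §2;
* VIOLATES N4 `Fact_hodge_F0` as soon as some `H⁰(X, ℚ) ≠ 0` (`PadH0J.not_fact_hodge_F0`), and violates the conclusion
  M30 `Fact_weightHodge` of `weightHodge_of_facts (M) (hN1) (hN2) (hN3) (hN4)` as soon as some `H⁰(A′, ℚ) ≠ 0` and N3
  holds in `U` (`PadH0J.not_fact_weightHodge`: under N3 every class of `H♭⁰(A′)` is a weight vector of the empty weight,
  but the pad classes are not of type `(0,0)`) — §3;
* so **N4 is independent of `ModelAxioms ∧ N1 ∧ N2 ∧ N3 ∧ F4 ∧ F5 ∧ Fact_dimProd ∧ W_RK4 ∧ PohlmannSpan ∧ HC_CM`**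
  (`PadH0J.exists_model_not_fact_hodge_F0`, given one such `U` with some `H⁰(A′) ≠ 0`; the unconditional instance on
  the exterior toy universe is `HodgeCM.Toy.fact_hodge_F0_independent` in `HodgeCM.Model.Toy.ToyPadH0J`).

Remark (scope of N4 in PerL).  `U♭ᴶ` keeps `PohlmannSpan` while losing N4 and M30 in degree `0`: in degree `0`
Pohlmann's span inclusion needs no Hodge theory (under N3 every class has the empty weight, which is a Hodge weight for
`p = 0`), so N4 enters `pohlmannSpan_of_facts` only through the degree-`0` case of M30, which the span inclusion does
not use.  Nothing is cited; Lean + Mathlib axioms only.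
-/

noncomputable section

open scoped TensorProduct

namespace HodgeCM

open Literature.AlgebraicGeometry.Motives (CMType HodgeStructure)
open Literature.AlgebraicGeometry.Motives.HodgeStructure (ofRat conj complexConj prodEquiv conj_ofRat conj_conj conj_smul
  mem_complexConj complexConj_top complexConj_bot conj_prodEquiv_symm)

/-! ## 1. The slope-pair Hodge structure on `B × B` -/

namespace SlopePad

variable (B : Type) [AddCommGroup B] [Module ℚ B]

/-- The `ℂ`-subspace `{(x, c·x)}` of `(B × B) ⊗ ℂ` (in the coordinates `prodEquiv`). -/
def slope (c : ℂ) : Submodule ℂ (ℂ ⊗[ℚ] (B × B)) :=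
  (LinearMap.graph (c • (LinearMap.id : ℂ ⊗[ℚ] B →ₗ[ℂ] ℂ ⊗[ℚ] B))).comap
    (prodEquiv B B : ℂ ⊗[ℚ] (B × B) →ₗ[ℂ] (ℂ ⊗[ℚ] B) × (ℂ ⊗[ℚ] B))

/-- (Ported verbatim from the HodgeCMPerL package; no docstring in the source.) -/
theorem mem_slope_iff (c : ℂ) (z : ℂ ⊗[ℚ] (B × B)) :
    z ∈ slope B c ↔ (prodEquiv B B z).2 = c • (prodEquiv B B z).1 := by
  rw [slope, Submodule.mem_comap, LinearMap.mem_graph_iff]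
  rfl

variable {B} in
/-- `prodEquiv` intertwines complex conjugation componentwise. -/
theorem prodEquiv_conj {B' : Type} [AddCommGroup B'] [Module ℚ B'] (z : ℂ ⊗[ℚ] (B × B')) :
    prodEquiv B B' (conj z) = (conj (prodEquiv B B' z).1, conj (prodEquiv B B' z).2) := by
  obtain ⟨⟨x, y⟩, rfl⟩ := (prodEquiv B B').symm.surjective z
  rw [conj_prodEquiv_symm, LinearEquiv.apply_symm_apply, LinearEquiv.apply_symm_apply]

/-- `conj {(x, c·x)} = {(x, c̄·x)}`. -/
theorem complexConj_slope (c : ℂ) : complexConj (slope B c) = slope B (starRingEnd ℂ c) := by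
  ext z
  rw [mem_complexConj, mem_slope_iff, mem_slope_iff, prodEquiv_conj]
  dsimp only
  constructor
  · intro h
    have h' := congrArg conj h
    rwa [conj_conj, conj_smul, conj_conj] at h'
  · intro h
    rw [h, conj_smul, starRingEnd_self_apply]

/-- Two slope subspaces of different slopes are complementary: `(x, y) = (a, c·a) + (b, d·b)` with
`b = (d - c)⁻¹ (y - c·x)`, `a = x - b`. -/
theorem isCompl_slope {c d : ℂ} (h : c ≠ d) : IsCompl (slope B c) (slope B d) := by
  have hcd : d - c ≠ 0 := sub_ne_zero.mpr (Ne.symm h)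
  constructor
  · refine Submodule.disjoint_def.mpr fun z hz hz' => ?_
    rw [mem_slope_iff] at hz hz'
    have hx : (prodEquiv B B z).1 = 0 := by
      have h1 : (d - c) • (prodEquiv B B z).1 = 0 := by rw [sub_smul, ← hz', ← hz, sub_self]
      exact (smul_eq_zero.mp h1).resolve_left hcd
    have hE : prodEquiv B B z = 0 := Prod.ext hx (by rw [hz, hx, smul_zero]; rfl)
    exact (prodEquiv B B).map_eq_zero_iff.mp hE
  · refine Submodule.codisjoint_iff_exists_add_eq.mpr fun z => ?_
    obtain ⟨⟨x, y⟩, rfl⟩ := (prodEquiv B B).symm.surjective z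
    refine ⟨(prodEquiv B B).symm (x - (d - c)⁻¹ • (y - c • x), c • (x - (d - c)⁻¹ • (y - c • x))),
      (prodEquiv B B).symm ((d - c)⁻¹ • (y - c • x), d • ((d - c)⁻¹ • (y - c • x))), ?_, ?_, ?_⟩
    · rw [mem_slope_iff, LinearEquiv.apply_symm_apply]
    · rw [mem_slope_iff, LinearEquiv.apply_symm_apply]
    · rw [← map_add, Prod.mk_add_mk, sub_add_cancel]
      congr 2
      rw [smul_sub, sub_add_eq_add_sub, ← sub_eq_zero]
      have : c • x + d • ((d - c)⁻¹ • (y - c • x)) - c • ((d - c)⁻¹ • (y - c • x)) - y =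
          ((d - c) * (d - c)⁻¹) • (y - c • x) - (y - c • x) := by
        rw [mul_smul, smul_sub (d - c)⁻¹ y, smul_sub, smul_sub, smul_sub, sub_smul, sub_smul]
        abel
      rw [this, mul_inv_cancel₀ hcd, one_smul, sub_self]

/-- `-i ≠ i`. -/
theorem neg_I_ne_I : -Complex.I ≠ Complex.I := by
  intro h
  have h' := congrArg Complex.im h
  norm_num at h'

/-- The Hodge filtration of the slope-pair structure: `⊤` for `p ≤ -1`, the slope `-i` subspace for `p = 0, 1`, `⊥` for
`p ≥ 2`. -/
def jF (p : ℤ) : Submodule ℂ (ℂ ⊗[ℚ] (B × B)) :=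
  if p ≤ -1 then ⊤ else if p ≤ 1 then slope B (-Complex.I) else ⊥

/-- (Ported verbatim from the HodgeCMPerL package; no docstring in the source.) -/
theorem jF_of_le {p : ℤ} (h : p ≤ -1) : jF B p = ⊤ := if_pos h

/-- (Ported verbatim from the HodgeCMPerL package; no docstring in the source.) -/
theorem jF_of_mid {p : ℤ} (h₁ : ¬ p ≤ -1) (h₂ : p ≤ 1) : jF B p = slope B (-Complex.I) := by
  rw [jF, if_neg h₁, if_pos h₂]

/-- (Ported verbatim from the HodgeCMPerL package; no docstring in the source.) -/
theorem jF_of_two_le {p : ℤ} (h : ¬ p ≤ 1) : jF B p = ⊥ := by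
  rw [jF, if_neg (by omega), if_neg h]

/-- (Ported verbatim from the HodgeCMPerL package; no docstring in the source.) -/
theorem complexConj_slope_neg_I : complexConj (slope B (-Complex.I)) = slope B Complex.I := by
  rw [complexConj_slope, map_neg, Complex.conj_I, neg_neg]

/-- **The slope-pair structure**: a `ℚ`-Hodge structure of weight `0` on `B × B`, of type `(1,-1) + (-1,1)`. -/
def jStructure : HodgeStructure (B × B) ((0 : ℕ) : ℤ) where
  F := jF B
  antitone_F := by
    intro p p' hpp'
    show jF B p' ≤ jF B p
    by_cases h1 : p ≤ -1
    · rw [jF_of_le B h1]; exact le_top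
    by_cases h1' : p' ≤ -1
    · exfalso; omega
    by_cases h2' : p' ≤ 1
    · rw [jF_of_mid B h1' h2', jF_of_mid B h1 (hpp'.trans h2')]
    · rw [jF_of_two_le B h2']; exact bot_le
  exists_F_eq_top := ⟨-1, jF_of_le B le_rfl⟩
  exists_F_eq_bot := ⟨2, jF_of_two_le B (by norm_num)⟩
  isCompl_F_complexConj := by
    intro p q hpq
    have hq : q = 1 - p := by rw [Nat.cast_zero, zero_add] at hpq; omega
    subst hq
    show IsCompl (jF B p) (complexConj (jF B (1 - p)))
    by_cases h1 : p ≤ -1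
    · rw [jF_of_le B h1, jF_of_two_le B (by omega), complexConj_bot]
      exact isCompl_top_bot
    by_cases h2 : p ≤ 1
    · rw [jF_of_mid B h1 h2, jF_of_mid B (by omega) (by omega), complexConj_slope_neg_I]
      exact isCompl_slope B neg_I_ne_I
    · rw [jF_of_two_le B h2, jF_of_le B (by omega), complexConj_top]
      exact isCompl_bot_top

/-- (Ported verbatim from the HodgeCMPerL package; no docstring in the source.) -/
theorem jStructure_F (p : ℤ) : (jStructure B).F p = jF B p := rfl

/-- (Ported verbatim from the HodgeCMPerL package; no docstring in the source.) -/
theorem jStructure_F_zero : (jStructure B).F 0 = slope B (-Complex.I) := by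
  rw [jStructure_F]; exact jF_of_mid B (by norm_num) (by norm_num)

/-- **The slope-pair structure has no nonzero rational Hodge class of level `0`** (a rational vector is fixed by `conj`,
so it would lie in `L ⊓ conj L = 0`). -/
theorem jStructure_hodgeClasses_zero : (jStructure B).hodgeClasses 0 = ⊥ := by
  refine (Submodule.eq_bot_iff _).mpr fun v hv => ?_
  rw [HodgeStructure.mem_hodgeClasses_iff, jStructure_F_zero] at hv
  have hv' : (ofRat v : ℂ ⊗[ℚ] (B × B)) ∈ slope B Complex.I := by
    have h : (ofRat v : ℂ ⊗[ℚ] (B × B)) ∈ complexConj (slope B (-Complex.I)) := by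
      rw [mem_complexConj, conj_ofRat]; exact hv
    rwa [complexConj_slope_neg_I] at h
  have h0 := Submodule.disjoint_def.mp (isCompl_slope B neg_I_ne_I).disjoint _ hv hv'
  exact PadZero.ofRat_injective (h0.trans (map_zero _).symm)

/-- **… and it is not effective in level `0`**: `F⁰ ≠ ⊤` as soon as `B ≠ 0` (the vector `(b, 0)` has a component of
slope `i`). -/
theorem jStructure_F_zero_ne_top [Nontrivial B] : (jStructure B).F 0 ≠ ⊤ := by
  intro h
  obtain ⟨b, hb⟩ := exists_ne (0 : B)
  have hz : (prodEquiv B B).symm (ofRat b, 0) ∈ (jStructure B).F 0 := by rw [h]; exact Submodule.mem_top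
  rw [jStructure_F_zero, mem_slope_iff, LinearEquiv.apply_symm_apply] at hz
  have h0 : (ofRat b : ℂ ⊗[ℚ] B) = 0 := by
    have h2 : -Complex.I • (ofRat b : ℂ ⊗[ℚ] B) = 0 := hz.symm
    exact (smul_eq_zero.mp h2).resolve_left (neg_ne_zero.mpr Complex.I_ne_zero)
  exact hb (PadZero.ofRat_injective (h0.trans (map_zero _).symm))

variable {B} in
/-- `prodEquiv` intertwines `(g × h) ⊗ ℂ` with `(g ⊗ ℂ) × (h ⊗ ℂ)`. -/
theorem prodEquiv_prodMap_baseChange {B' C C' : Type} [AddCommGroup B'] [Module ℚ B'] [AddCommGroup C] [Module ℚ C]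
    [AddCommGroup C'] [Module ℚ C'] (g : B →ₗ[ℚ] B') (h : C →ₗ[ℚ] C') (z : ℂ ⊗[ℚ] (B × C)) :
    prodEquiv B' C' ((LinearMap.prodMap g h).baseChange ℂ z) =
      (g.baseChange ℂ (prodEquiv B C z).1, h.baseChange ℂ (prodEquiv B C z).2) := by
  induction z using TensorProduct.induction_on with
  | zero => simp only [map_zero, Prod.fst_zero, Prod.snd_zero]; rfl
  | tmul a v => simp [prodEquiv, LinearMap.baseChange_tmul]
  | add x y hx hy =>
    rw [map_add, map_add, hx, hy, map_add, Prod.fst_add, Prod.snd_add, map_add, map_add, Prod.mk_add_mk]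

variable {B} in
/-- Diagonal maps `g × g` preserve the slope subspaces. -/
theorem map_slope_le {B' : Type} [AddCommGroup B'] [Module ℚ B'] (g : B →ₗ[ℚ] B') (c : ℂ) :
    (slope B c).map ((LinearMap.prodMap g g).baseChange ℂ) ≤ slope B' c := by
  rintro _ ⟨z, hz, rfl⟩
  rw [SetLike.mem_coe, mem_slope_iff] at hz
  rw [mem_slope_iff, prodEquiv_prodMap_baseChange, hz, map_smul]

variable {B} in
/-- **Naturality**: every diagonal map `g × g`, `g : B → B'` `ℚ`-linear, is a morphism of slope-pair structures. -/
theorem jStructure_map_F_le {B' : Type} [AddCommGroup B'] [Module ℚ B'] (g : B →ₗ[ℚ] B') (p : ℤ) :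
    ((jStructure B).F p).map ((LinearMap.prodMap g g).baseChange ℂ) ≤ (jStructure B').F p := by
  rw [jStructure_F, jStructure_F]
  by_cases h1 : p ≤ -1
  · rw [jF_of_le B' h1]; exact le_top
  by_cases h2 : p ≤ 1
  · rw [jF_of_mid B h1 h2, jF_of_mid B' h1 h2]; exact map_slope_le g _
  · rw [jF_of_two_le B h2, Submodule.map_bot]; exact bot_le

end SlopePad

/-! ## 2. The datum `P(X) = H⁰(X) × H⁰(X)` and the padded universe `U♭ᴶ` -/

namespace Universe

variable (U : Universe)

/-- **Datum A**: the pad `H⁰(X, ℚ) × H⁰(X, ℚ)` with the slope-pair structure and the diagonal action `f^* × f^*`. -/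
def padDatumJ : U.PadDatum where
  P X := U.Coh X 0 × U.Coh X 0
  hs X := SlopePad.jStructure (U.Coh X 0)
  map f := LinearMap.prodMap (U.pull f 0) (U.pull f 0)

namespace PadH0J

variable {U}

/-- (Ported verbatim from the HodgeCMPerL package; no docstring in the source.) -/
theorem map_eq {X Y : U.Var} (f : U.Mor X Y) : U.padDatumJ.map f = LinearMap.prodMap (U.pull f 0) (U.pull f 0) := rfl

/-- (Ported verbatim from the HodgeCMPerL package; no docstring in the source.) -/
theorem hs_eq (X : U.Var) : U.padDatumJ.hs X = SlopePad.jStructure (U.Coh X 0) := rfl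

/-- The pad laws hold whenever `U` is a model (M1, M2, M14; Hodge compatibility by naturality of the slope-pair
structure; the domination witnesses of M14 act trivially on the pad since `(π ∘ s)^* = N⁰ = 1` on `H⁰`). -/
theorem laws (M : U.ModelAxioms) : U.padDatumJ.Laws where
  map_id X := by rw [map_eq, M.pull_id X 0]; exact LinearMap.prodMap_id
  map_comp X Y Z f g := by rw [map_eq, map_eq, map_eq, M.pull_comp X Y Z f g 0]; exact (LinearMap.prodMap_comp _ _ _ _).symm
  map_hodge X Y f p := by rw [map_eq, hs_eq, hs_eq]; exact SlopePad.jStructure_map_F_le _ p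
  dominated X hX := by
    obtain ⟨F, hG, h6, n, Θ, s, π, N, hN, h⟩ := M.cmDominated X hX
    refine ⟨F, hG, h6, n, Θ, s, π, N, hN, h, ?_⟩
    rw [map_eq, h 0, pow_zero, one_smul]
    exact LinearMap.prodMap_id

/-- **`U♭ᴶ` is a model whenever `U` is** (and `dim (X × Y) = dim X + dim Y`, for M28). -/
theorem modelAxioms (M : U.ModelAxioms) (hd : U.Fact_dimProd) : (U.padH0 U.padDatumJ).ModelAxioms :=
  PadH0.modelAxioms M hd (laws M)

/-- N3 transfers to `U♭ᴶ` (the pad action of an endomorphism `f` is `f^* × f^* = 1`). -/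
theorem fact_pull_H0 (h : U.Fact_pull_H0) : (U.padH0 U.padDatumJ).Fact_pull_H0 :=
  PadH0.fact_pull_H0_iff.mpr ⟨h, fun X f => by rw [map_eq, h X f]; exact LinearMap.prodMap_id⟩

/-- The pad of `U♭ᴶ` carries no nonzero rational Hodge class. -/
theorem pad_hodgeClasses (X : U.Var) : (U.padDatumJ.hs X).hodgeClasses 0 = ⊥ :=
  SlopePad.jStructure_hodgeClasses_zero _

/-- Pohlmann's span inclusion transfers to `U♭ᴶ`. -/
theorem pohlmannSpan (h : U.PohlmannSpan) : (U.padH0 U.padDatumJ).PohlmannSpan :=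
  PadH0.pohlmannSpan_of_padHodge pad_hodgeClasses h

/-- COR-CM holds in `U♭ᴶ` iff it holds in `U`. -/
theorem hc_cm_iff : (U.padH0 U.padDatumJ).HC_CM ↔ U.HC_CM :=
  ⟨PadH0.hc_cm_toU, PadH0.hc_cm_of_padHodge pad_hodgeClasses⟩

/-! ## 3. N4 and M30 fail in `U♭ᴶ` -/

/-- **N4 `Fact_hodge_F0` FAILS in `U♭ᴶ`** as soon as some `H⁰(X, ℚ) ≠ 0`: the pad structure on `H⁰(X) × H⁰(X)` has
`F⁰ ≠ ⊤`. -/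
theorem not_fact_hodge_F0 (hX : ∃ X : U.Var, Nontrivial (U.Coh X 0)) : ¬ (U.padH0 U.padDatumJ).Fact_hodge_F0 := by
  intro h
  obtain ⟨X, hX⟩ := hX
  exact SlopePad.jStructure_F_zero_ne_top (U.Coh X 0) ((PadH0.fact_hodge_F0_iff.mp h).2 X)

set_option smartUnfolding false in
/-- **M30 `Fact_weightHodge` FAILS in `U♭ᴶ`** whenever N3 holds in `U` and some `H⁰(A′, ℚ) ≠ 0`: under N3 every class of
`H♭⁰(A′)` is a weight vector of the empty weight (degree `0`), so M30 would put the rational pad class `((b, 0))`,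
`b ≠ 0`, into the piece `H♭^{0,0} ⊆ F⁰`, i.e. make `(b, 0)` a rational Hodge class of the slope-pair structure — which
has none. -/
theorem not_fact_weightHodge (hN3 : U.Fact_pull_H0)
    (h0 : ∃ (F : CMField) (n : ℕ) (Θ : Fin (n + 1) → CMType F), Nontrivial (U.Coh (U.cmProd F Θ) 0)) :
    ¬ (U.padH0 U.padDatumJ).Fact_weightHodge := by
  intro h
  obtain ⟨F, n, Θ, hnt⟩ := h0
  haveI : Nontrivial (U.Coh ((U.padH0 U.padDatumJ).cmProd F Θ) 0) := hnt
  obtain ⟨b, hb⟩ := exists_ne (0 : U.Coh ((U.padH0 U.padDatumJ).cmProd F Θ) 0)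
  have h3 := fact_pull_H0 hN3
  -- the rational pad class `v = (0 ; (b, 0))` of `H♭⁰(A′)` is a weight vector of the empty weight
  have hv : (U.padH0 U.padDatumJ).IsWeightVector F Θ (fun _ => ∅) 0
      (ofRat (PadH0.ofPad U.padDatumJ ((U.padH0 U.padDatumJ).cmProd F Θ) 0 (b, 0))) := by
    intro j a M _
    rw [Finset.prod_empty, one_smul]
    show ((U.padH0 U.padDatumJ).pull M 0).baseChange ℂ _ = _
    rw [h3 _ M, LinearMap.baseChange_id, LinearMap.id_apply]
  have hx := h F n Θ 0 (fun _ => ∅) hv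
  simp only [Finset.sum_empty, Finset.sum_const_zero] at hx
  have hF := ((PadH0.ofRat_mem_F_iff _ 0 0 _).mp (HodgeStructure.piece_le_F _ _ _ hx)).2
  rw [PadH0.padOf_ofPad_zero] at hF
  -- so `(b, 0)` would be a rational Hodge class of the slope-pair structure
  have hcl : ((b, 0) : U.Coh ((U.padH0 U.padDatumJ).cmProd F Θ) 0 × U.Coh ((U.padH0 U.padDatumJ).cmProd F Θ) 0) ∈
      (SlopePad.jStructure _).hodgeClasses 0 := hF
  rw [SlopePad.jStructure_hodgeClasses_zero, Submodule.mem_bot, Prod.mk_eq_zero] at hcl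
  exact hb hcl.1

/-- **Separation theorem for N4.**  If `U` is a model with `Fact_dimProd`, N1, N2, N3, F4, F5, `W_RK4`, Pohlmann's span
inclusion and COR-CM, and some `H⁰(A′, ℚ) ≠ 0`, then `U♭ᴶ` has all of these and violates N4 and M30: so N4 is not a
consequence of the other axioms and inputs, and it is the load-bearing input of the degree-`0` case of
`weightHodge_of_facts`. -/
theorem exists_model_not_fact_hodge_F0 (M : U.ModelAxioms) (hd : U.Fact_dimProd) (hN1 : U.Fact_cupExterior)
    (hN2 : U.Fact_cup_hodge) (hN3 : U.Fact_pull_H0) (hF4 : U.Fact_cupAlg) (hF5 : U.Fact_cupAssoc) (hW : U.W_RK4)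
    (hPS : U.PohlmannSpan) (hHC : U.HC_CM)
    (h0 : ∃ (F : CMField) (n : ℕ) (Θ : Fin (n + 1) → CMType F), Nontrivial (U.Coh (U.cmProd F Θ) 0)) :
    ∃ U' : Universe, U'.ModelAxioms ∧ U'.Fact_dimProd ∧ U'.Fact_cupExterior ∧ U'.Fact_cup_hodge ∧ U'.Fact_pull_H0 ∧
      U'.Fact_cupAlg ∧ U'.Fact_cupAssoc ∧ U'.W_RK4 ∧ U'.PohlmannSpan ∧ U'.HC_CM ∧
      ¬ U'.Fact_hodge_F0 ∧ ¬ U'.Fact_weightHodge := by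
  obtain ⟨F, n, Θ, hnt⟩ := h0
  exact ⟨U.padH0 U.padDatumJ, modelAxioms M hd, PadH0.fact_dimProd_iff.mpr hd, PadH0.fact_cupExterior_iff.mpr hN1,
    PadH0.fact_cup_hodge hN2, fact_pull_H0 hN3, PadH0.fact_cupAlg hF4, PadH0.fact_cupAssoc hF5, PadH0.w_RK4_iff.mpr hW,
    pohlmannSpan hPS, hc_cm_iff.mpr hHC, not_fact_hodge_F0 ⟨U.cmProd F Θ, hnt⟩, not_fact_weightHodge hN3 ⟨F, n, Θ, hnt⟩⟩

end PadH0J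

end Universe

end HodgeCM

end
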